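import Literature.AlgebraicGeometry.ModuliOfAbelianVarieties.SiegelAdmissibleChangeLevel
import Literature.AlgebraicGeometry.ModuliOfAbelianVarieties.SiegelAdmissibleClassUniqueTwoReps
import Literature.AlgebraicGeometry.ModuliOfAbelianVarieties.SiegelAdelicMarkingPrincipalTransport
import HarnessLib

/-!
# Aligning two readings of one triple: admissibility of a level-`N′` triple at the `(Z, r)` where its level-`N` image is read

Layer `Literature/AlgebraicGeometry/ModuliOfAbelianVarieties`, namespace `Literature.AlgebraicGeometry.ModuliOfAbelianVarieties`.
THEOREMS ONLY (no definition, no named fact, no instance).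

Setting of ★ (U) `IsAdmissibleAt hδ r Z hZ P′` (marking of the fibre by `[J(Z), r]`, ample `Θ`, symplectic lift read through
`r`), of the rational move of a marking ★ `SiegelAdelicMarking.rationalMove` (`[J, a] ↦ [qJq⁻¹, q̂·a]`, `q ∈ GSp_δ(ℚ)`; torsion
parametrisation `v ↦ u(q⁻¹v)`, congruence clause ★ `adelicCongr_rationalMove_iff`), of the level change ★
`IsAdmissibleAt.changeLevel` (p741677) and of the class injectivity ★ `siegelShimuraSet_mk_eq_of_isAdmissibleAt₂`
([Milne2005ShimuraVarieties] Thm. 6.11 at two integral representatives).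

* `IsAdmissibleAt.rationalMove` — **admissibility is invariant under the diagonal `GSp_δ(ℚ)`-action**: `P′` admissible at
  `(Z, r)` and `q ∈ GSp_δ(ℚ)` with `q·J(Z)·q⁻¹ = J(Z′)` ⇒ `P′` admissible at `(Z′, q̂·r)` (same `Θ`, same lift; the marking
  moved by `q`) — [Milne2005ShimuraVarieties] §6 p. 75 «the triple of `[x, a]` depends only on the class `G(ℚ)(x, a)K`», Lemma
  5.13; the Literature-side twin of the (P)-skeleton's `MarkedBy.mulLeft`.
* `IsAdmissibleAt.exists_mul_mem_principalLevelSubgroup_of_changeLevel` — **ALIGNING TWO READINGS**: let `P` be a level-`N′`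
  triple over `Spec ℂ`, `N′ = N·d`, `N ≥ 3`, admissible at SOME `(Z₀, r₀)` with `r₀ ∈ K_δ(1)`; if its level-`N` image
  `P.changeLevel N d` is admissible at `(Z, r)` with `r ∈ K_δ(1)`, then `P` ITSELF is admissible at `(Z, r·k)` for some
  `k ∈ K_δ(N)`.  Proof: both `(Z, r)` and `(Z₀, r₀)` read `P.changeLevel` (the second by `IsAdmissibleAt.changeLevel`), so
  `[J(Z), rK_δ(N)] = [J(Z₀), r₀K_δ(N)]` (★ `siegelShimuraSet_mk_eq_of_isAdmissibleAt₂`), i.e. `J(Z) = γJ(Z₀)γ⁻¹` and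
  `γ̂ r₀ = r k` with `γ ∈ GSp_δ(ℚ)`, `k ∈ K_δ(N)` (★ `SiegelShimuraSet.mk_eq_mk_iff`); move the level-`N′` reading at
  `(Z₀, r₀)` by `γ`.  No right translation by `K_δ(N)` is needed (the `k` is absorbed into the conclusion), so no
  re-indexing of the lift occurs.
* `exists_isAdmissibleAt_mul_of_changeLevel` — the consumer spelling asked by the HECKE-LINK glue (B-p08 (g9) 20:10:39Z):
  level `N * m`, `0 < m`, `changeLevel N m rfl _`.

Cell `hodgecm-mathlib` (D-0151), E-road residual `stub_noThinPiece`, HECKE-LINK line (B-plan1 (g14) hand 20:10:54Z «(U) align two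
readings»); consumers: the socket-(A) glue (B-p08) feeding (A4) (B-p13) a level-`N′` reading of the lifted triple at
`(P • Z_x, r·k)`, `k ∈ K_δ(N)` (QA5).  Count-neutral; HC_CM is proved only modulo the 7 printed citations until rung 0 closes.

## References
* [Milne2005ShimuraVarieties] J. S. Milne, *Introduction to Shimura varieties* (2005), §5 p. 57 (the double-coset
  description (32) and Lemma 5.13), §6 Thm. 6.11 pp. 74–75.
* [Deligne1971TravauxShimura] P. Deligne, Travaux de Shimura (1971), 4.11–4.12 pp. 148–149, 4.16 p. 150.
* [Lan2013PELCompactifications] K.-W. Lan, *Arithmetic compactifications of PEL-type Shimura varieties* (2013), §1.3.6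
  Lemma 1.3.6.5 (p. 81).
-/

set_option autoImplicit false

noncomputable section

open CategoryTheory CategoryTheory.Limits AlgebraicGeometry Matrix
open Literature.AlgebraicGeometry.Motives (SchemeOver AlgPoints specOver)
open Literature.AlgebraicGeometry.AbelianSchemes (PolarizedAbelianSchemeWithLevel)
open Literature.NumberTheory.Automorphic (siegelUpperHalfSpace)

namespace Literature.AlgebraicGeometry.ModuliOfAbelianVarieties

open SiegelModuli (jOfSiegel)

variable {g N : ℕ} {δ : Fin g → ℕ}

/-! ## §1 Admissibility is invariant under the diagonal `GSp_δ(ℚ)`-action -/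

/-- **Admissibility moves with `q ∈ GSp_δ(ℚ)`** ([Milne2005ShimuraVarieties] §6 p. 75: the triple attached to `[x, a]` only
depends on the class of `(x, a)` under the diagonal `G(ℚ)`-action): if `P′` is admissible at `(Z, r)` and
`q·J(Z)·q⁻¹ = J(Z′)`, then `P′` is admissible at `(Z′, q̂·r)` — with the same `Θ` and the same symplectic lift, the marking
being replaced by its rational move ★ `SiegelAdelicMarking.rationalMove` (re-indexed along `q·J(Z)·q⁻¹ = J(Z′)`), whose
torsion parametrisation is `v ↦ u(q⁻¹v)` and whose congruence clause is the old one at `q⁻¹v`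
(★ `adelicCongr_rationalMove_iff`). [cite: Milne2005ShimuraVarieties, §5 p. 57 (Lemma 5.13) and §6 Thm. 6.11 pp. 74–75]
[cite: Deligne1971TravauxShimura, 4.11–4.12 pp. 148–149] -/
theorem IsAdmissibleAt.rationalMove {hδ : IsPolarizationType δ} {r : gspFinAdelic δ}
    {Z Z' : Matrix (Fin g) (Fin g) ℂ} {hZ : Z ∈ siegelUpperHalfSpace g} {hZ' : Z' ∈ siegelUpperHalfSpace g}
    {P' : PolarizedAbelianSchemeWithLevel g N δ (specOver ℚ ℂ).left} (h : IsAdmissibleAt hδ r Z hZ P')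
    (q : gspRational δ)
    (hJ : conjAct δ (gspRationalToReal δ q) ⟨jOfSiegel δ Z, SiegelComplexRecordSystem.jOfSiegel_mem_C0pm hδ.1 hZ⟩ =
      ⟨jOfSiegel δ Z', SiegelComplexRecordSystem.jOfSiegel_mem_C0pm hδ.1 hZ'⟩)
    {a' : gspFinAdelic δ} (ha : (gspRationalToFinAdelic δ q : gspFinAdelic δ) * r = a') :
    IsAdmissibleAt hδ a' Z' hZ' P' := by
  subst ha
  obtain ⟨m, Θ, Λ, hample, hlam, htower⟩ := h
  obtain ⟨m', -, -, -, hr'⟩ := SiegelAdelicMarking.exists_of_eq hJ (m.rationalMove q)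
  refine ⟨m', Θ, Λ, hample, hlam, fun M hNM hM0 x v hv => ?_⟩
  rw [hr', SiegelAdelicMarking.rationalMove_r]
  exact htower hNM hM0 x _ ((SiegelAdelicMarking.adelicCongr_rationalMove_iff (a := r) q 1 v _).1 hv)

/-! ## §2 Aligning two readings of one triple -/

/-- **ALIGNING TWO READINGS.**  Let `P` be a level-`N′` triple over `Spec ℂ` (`N′ = N·d`, `N ≥ 3`) admissible at some
`(Z₀, r₀)`, `r₀ ∈ K_δ(1)`, and suppose its level-`N` image `P.changeLevel N d` is admissible at `(Z, r)`, `r ∈ K_δ(1)`.  Then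
`P` itself is admissible at `(Z, r·k)` for some `k ∈ K_δ(N)`: the two level-`N` readings `(Z, r)` and `(Z₀, r₀)` of ONE
triple (★ `IsAdmissibleAt.changeLevel`) have the same class `[J(Z), rK_δ(N)] = [J(Z₀), r₀K_δ(N)]` (★
`siegelShimuraSet_mk_eq_of_isAdmissibleAt₂`, [Milne2005ShimuraVarieties] Thm. 6.11), so `J(Z) = γJ(Z₀)γ⁻¹`, `γ̂r₀ = rk`
(`γ ∈ GSp_δ(ℚ)`, `k ∈ K_δ(N)`; ★ `SiegelShimuraSet.mk_eq_mk_iff`), and the level-`N′` reading moves along `γ` (§1).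
[cite: Milne2005ShimuraVarieties, Lemma 5.13 p. 57 and §6 Thm. 6.11 pp. 74–75] [cite: Deligne1971TravauxShimura, 4.16 p. 150]
[cite: Lan2013PELCompactifications, §1.3.6 Lemma 1.3.6.5 (p. 81)] -/
theorem IsAdmissibleAt.exists_mul_mem_principalLevelSubgroup_of_changeLevel (hg : 0 < g) {hδ : IsPolarizationType δ}
    (hN : 3 ≤ N) {r r₀ : gspFinAdelic δ} (hr : r ∈ principalLevelSubgroup δ 1) (hr₀ : r₀ ∈ principalLevelSubgroup δ 1)
    {Z Z₀ : Matrix (Fin g) (Fin g) ℂ} {hZ : Z ∈ siegelUpperHalfSpace g} {hZ₀ : Z₀ ∈ siegelUpperHalfSpace g}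
    {N' : ℕ} {P : PolarizedAbelianSchemeWithLevel g N' δ (specOver ℚ ℂ).left}
    (h₀ : IsAdmissibleAt hδ r₀ Z₀ hZ₀ P) (d : ℕ) (hd : N' = N * d) (hN' : N' ≠ 0)
    (h : IsAdmissibleAt hδ r Z hZ (P.changeLevel N d hd hN')) :
    ∃ k ∈ principalLevelSubgroup δ N, IsAdmissibleAt hδ (r * k) Z hZ P := by
  -- the two level-`N` readings of `P.changeLevel N d` have the same class in `Sh_{K_δ(N)}`
  have heq := siegelShimuraSet_mk_eq_of_isAdmissibleAt₂ hg hδ hN hr hr₀ hZ hZ₀ (P.changeLevel N d hd hN')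
    h (h₀.changeLevel N d hd hN')
  obtain ⟨γ, hγJ, hγa⟩ := (SiegelShimuraSet.mk_eq_mk_iff δ (principalLevelSubgroup δ N) _ _ r r₀).1 heq
  rw [MulAction.Quotient.smul_coe, QuotientGroup.eq, smul_eq_mul] at hγa
  -- `hγa : (γ̂ r₀)⁻¹ r ∈ K_δ(N)`; take `k := ((γ̂ r₀)⁻¹ r)⁻¹ = r⁻¹ γ̂ r₀`, so that `γ̂ r₀ = r k`
  refine ⟨(((gspRationalToFinAdelic δ γ : gspFinAdelic δ) * r₀)⁻¹ * r)⁻¹, inv_mem hγa, h₀.rationalMove γ hγJ ?_⟩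
  group

/-- **Consumer spelling for the HECKE-LINK glue** (B-p08 (g9) 20:10:39Z «(U) align two readings»): a level-`N·m` triple `P₀′`
(`0 < m`, `3 ≤ N`) admissible at some `(Z₀, r₀)` with `r₀ ∈ K_δ(1)`, whose level-`N` image `P₀′.changeLevel N m` is admissible
at `(Z, r)` with `r ∈ K_δ(1)`, is admissible at `(Z, r·u)` for some `u ∈ K_δ(N)`.
[cite: Milne2005ShimuraVarieties, Lemma 5.13 p. 57 and §6 Thm. 6.11 pp. 74–75] [cite: Deligne1971TravauxShimura, 4.16 p. 150] -/
theorem exists_isAdmissibleAt_mul_of_changeLevel (hg : 0 < g) (hδ : IsPolarizationType δ) (hN : 3 ≤ N)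
    {r r₀ : gspFinAdelic δ} (hr : r ∈ principalLevelSubgroup δ 1) (hr₀ : r₀ ∈ principalLevelSubgroup δ 1)
    (Z Z₀ : siegelUpperHalfSpace g) {m : ℕ} (hm : 0 < m)
    (P₀' : PolarizedAbelianSchemeWithLevel g (N * m) δ (specOver ℚ ℂ).left)
    (h₀ : IsAdmissibleAt hδ r₀ Z₀.1 Z₀.2 P₀')
    (h : IsAdmissibleAt hδ r Z.1 Z.2 (P₀'.changeLevel N m rfl (Nat.mul_ne_zero (by omega) hm.ne'))) :
    ∃ u ∈ principalLevelSubgroup δ N, IsAdmissibleAt hδ (r * u) Z.1 Z.2 P₀' :=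
  h₀.exists_mul_mem_principalLevelSubgroup_of_changeLevel hg hN hr hr₀ m rfl _ h

end Literature.AlgebraicGeometry.ModuliOfAbelianVarieties

end
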